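import Summits.PneNP.PneNP.Theorems.ConvexRankGatesConvexGateBlindExactLiftingTriangleTwoDirBlind

/-!
# Triangle instance — the MONO-HEAVINESS calculus, III: interaction-free atoms are line- and point-spread (lead c6)

Support file for crux `ConvexGateBlind` (stmt-PneNP-10680), line `xor-door-perfect-completeness`, open stub
`stub_exactLifting`; sequel of `…TriangleMonoHeavy` / `…TriangleTwoDirBlind`.  The counting interface of parts I–II
(every balanced row of a factorisation of `M_t − εJ`, `ε > 0`, is served by a Mono-heavy atom; two-directional atoms are
never heavy) becomes a lower bound as soon as a class of atoms is RARELY heavy.  The conjectural LEMMA N (memo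
`ExactLifting-c6.md`: an interaction-free non-negative function is Mono-heavy for an exponentially small fraction of the
balanced rows) rests on three deterministic facts about an INTERACTION-FREE function `v(a,b,d) = f(a,b) + g(b,d) + h(a,d)`,
recorded here:

* §5 **Reconstruction identity** (`if_reconstruction`): `t³·v(w) = t²·ℓ(w) − t·p(w) + m`, where `ℓ(w)` is the total mass
  of the three lines through `w`, `p(w)` that of the three planes through `w`, `m` the total mass (the ANOVA inversion
  for a function without 3-way interaction; no sign hypothesis).
* §6 **Spread at a zero** (`lineMass_le_of_zero`, `value_le`): if moreover `v ≥ 0` and `v(w₀) = 0`, then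
  `t²·ℓ(w₀) + m = t·p(w₀)`, so every line through a zero carries at most `p(w₀)/t − m/t²` — less than `3/t` of the
  heaviest plane; and everywhere `t³ v(w) ≤ t² ℓ(w) + m`.  A LINE-FREE `v` (every line contains a zero — the normal
  form reached by peeling lines, §7) therefore has all `3t²` line masses below `3·(max plane)/t` and all values below
  `9·(max plane)/t² + m/t³`: interaction-free non-negative atoms cannot concentrate on lines or points without being
  (partly) unions of lines.
* §7 **Peeling is free** (`heav_sub_line_ge`, `monoHeavy_sub_line`): subtracting `c·𝟙_L` (`c ≥ 0`, any line `L`) from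
  an atom does not decrease its heaviness at any balanced colouring (lines are two-directional, part II), so the heavy
  rows of an atom are among the heavy rows of any of its line-peelings; lower bounds may assume atoms line-free.

Nothing here is cited; everything is elementary.
-/

set_option linter.dupNamespace false -- `Summit.PneNP.PneNP.…`: summit = sub-problem (D-0017)

namespace Summit.PneNP.PneNP.Theorems.XorDoor.TriLine.Heavy

open Finset

noncomputable section

variable {t : ℕ}

/-! ## §5 The reconstruction identity for interaction-free functions -/

/-- total mass of the three lines through `(a, b, d)` -/
def lineMass3 (v : Tri t → ℝ) (a b d : Fin t) : ℝ :=
  (∑ a', v (a', b, d)) + (∑ b', v (a, b', d)) + ∑ d', v (a, b, d')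

/-- total mass of the three planes through `(a, b, d)` -/
def planeMass3 (v : Tri t → ℝ) (a b d : Fin t) : ℝ :=
  (∑ b', ∑ d', v (a, b', d')) + (∑ a', ∑ d', v (a', b, d')) + ∑ a', ∑ b', v (a', b', d)

/-- total mass -/
def totalMass (v : Tri t → ℝ) : ℝ := ∑ a, ∑ b, ∑ d, v (a, b, d)

/-- **Reconstruction identity.**  For an interaction-free `v = f(a,b) + g(b,d) + h(a,d)`:
`t³ v(a,b,d) = t² ℓ(a,b,d) − t p(a,b,d) + m`. -/
theorem if_reconstruction {v : Tri t → ℝ} (f g h : Fin t → Fin t → ℝ)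
    (hv : ∀ a b d, v (a, b, d) = f a b + g b d + h a d) (a b d : Fin t) :
    (t : ℝ) ^ 3 * v (a, b, d) = (t : ℝ) ^ 2 * lineMass3 v a b d - t * planeMass3 v a b d + totalMass v := by
  simp only [lineMass3, planeMass3, totalMass, hv, sum_add_distrib, sum_const, card_univ, Fintype.card_fin,
    nsmul_eq_mul]
  simp only [← mul_sum]
  ring

/-! ## §6 Spread of a non-negative interaction-free function at a zero -/

/-- **At a zero, the planes pay for the lines**: `t² ℓ(w₀) + m = t p(w₀)` when `v(w₀) = 0`. -/
theorem lineMass3_eq_of_zero {v : Tri t → ℝ} (f g h : Fin t → Fin t → ℝ)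
    (hv : ∀ a b d, v (a, b, d) = f a b + g b d + h a d) {a b d : Fin t} (h0 : v (a, b, d) = 0) :
    (t : ℝ) ^ 2 * lineMass3 v a b d + totalMass v = t * planeMass3 v a b d := by
  have := if_reconstruction f g h hv a b d
  rw [h0, mul_zero] at this
  linarith

/-- each of the three lines through a zero of a non-negative interaction-free `v` carries at most `p(w₀)/t − m/t²`:
here the line in the first direction (the other two are symmetric summands of `lineMass3`) -/
theorem lineMass_le_of_zero {v : Tri t → ℝ} (hnn : ∀ w, 0 ≤ v w) (f g h : Fin t → Fin t → ℝ)
    (hv : ∀ a b d, v (a, b, d) = f a b + g b d + h a d) {a b d : Fin t} (h0 : v (a, b, d) = 0) :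
    (t : ℝ) ^ 2 * (∑ a', v (a', b, d)) + totalMass v ≤ t * planeMass3 v a b d := by
  have h := lineMass3_eq_of_zero f g h hv h0
  have h2 : 0 ≤ ∑ b', v (a, b', d) := sum_nonneg fun _ _ => hnn _
  have h3 : 0 ≤ ∑ d', v (a, b, d') := sum_nonneg fun _ _ => hnn _
  have hT : (0 : ℝ) ≤ (t : ℝ) ^ 2 := by positivity
  have : (t : ℝ) ^ 2 * (∑ a', v (a', b, d)) ≤ (t : ℝ) ^ 2 * lineMass3 v a b d := by
    unfold lineMass3
    nlinarith
  linarith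

/-- **Point-spread**: everywhere `t³ v(w) ≤ t² ℓ(w) + m` (the planes only subtract). -/
theorem value_le {v : Tri t → ℝ} (hnn : ∀ w, 0 ≤ v w) (f g h : Fin t → Fin t → ℝ)
    (hv : ∀ a b d, v (a, b, d) = f a b + g b d + h a d) (a b d : Fin t) :
    (t : ℝ) ^ 3 * v (a, b, d) ≤ (t : ℝ) ^ 2 * lineMass3 v a b d + totalMass v := by
  have h := if_reconstruction f g h hv a b d
  have hp : 0 ≤ planeMass3 v a b d := by
    unfold planeMass3
    refine add_nonneg (add_nonneg ?_ ?_) ?_ <;>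
      exact sum_nonneg fun _ _ => sum_nonneg fun _ _ => hnn _
  have hT : (0 : ℝ) ≤ t := Nat.cast_nonneg t
  nlinarith

/-- `v` is line-free: every line contains a zero of `v`. -/
def LineFree (v : Tri t → ℝ) : Prop :=
  (∀ b d, ∃ a, v (a, b, d) = 0) ∧ (∀ a d, ∃ b, v (a, b, d) = 0) ∧ (∀ a b, ∃ d, v (a, b, d) = 0)

/-- all planes of `v` carry at most `P` -/
def PlaneBound (v : Tri t → ℝ) (P : ℝ) : Prop :=
  (∀ a, ∑ b', ∑ d', v (a, b', d') ≤ P) ∧ (∀ b, ∑ a', ∑ d', v (a', b, d') ≤ P) ∧ (∀ d, ∑ a', ∑ b', v (a', b', d) ≤ P)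

/-- **Line-spread of line-free atoms**: if every line of the non-negative interaction-free `v` contains a zero and every
plane carries at most `P`, then every line (here: first direction) carries at most `3P/t − m/t²`, stated without
division: `t² · (line mass) + m ≤ 3tP`. -/
theorem lineFree_lineMass_le {v : Tri t → ℝ} (hnn : ∀ w, 0 ≤ v w) (f g h : Fin t → Fin t → ℝ)
    (hv : ∀ a b d, v (a, b, d) = f a b + g b d + h a d) (hlf : LineFree v) {P : ℝ} (hP : PlaneBound v P)
    (b d : Fin t) : (t : ℝ) ^ 2 * (∑ a', v (a', b, d)) + totalMass v ≤ 3 * t * P := by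
  obtain ⟨a, ha⟩ := hlf.1 b d
  have h := lineMass_le_of_zero hnn f g h hv ha
  have hp : planeMass3 v a b d ≤ 3 * P := by
    unfold planeMass3
    linarith [hP.1 a, hP.2.1 b, hP.2.2 d]
  have hT : (0 : ℝ) ≤ t := Nat.cast_nonneg t
  nlinarith

/-! ## §7 Peeling lines is free -/

/-- the indicator of the line `{(·, b, d)}` scaled by `c` -/
def lineFun1 (c : ℝ) (b d : Fin t) : Tri t → ℝ := fun w => if w.2.1 = b ∧ w.2.2 = d then c else 0

/-- a scaled line of the first direction is two-directional (shared `b`: `f a b' = 0`, `h b' d' = c·[b'=b][d'=d]`) -/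
lemma twoDir_lineFun1 (c : ℝ) (b d : Fin t) : TwoDir (lineFun1 c b d) :=
  Or.inr (Or.inl ⟨fun _ _ => 0, fun b' d' => if b' = b ∧ d' = d then c else 0, fun a' b' d' => by
    simp [lineFun1]⟩)

/-- **Peeling a line does not decrease heaviness** (at any balanced colouring, any `c ≥ 0`, first direction; the other
two directions are identical with `TwoDir`'s other shapes). -/
theorem heav_sub_line_ge {x : Col t} (hx : Balanced x) (v : Tri t → ℝ) {c : ℝ} (hc : 0 ≤ c) (b d : Fin t) :
    heav x v ≤ heav x (fun w => v w - lineFun1 c b d w) := by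
  have hlin : heav x (fun w => v w - lineFun1 c b d w) = heav x v - heav x (lineFun1 c b d) := by
    simp only [heav, mul_sub, sum_sub_distrib]
  have hle : heav x (lineFun1 c b d) ≤ 0 :=
    heav_nonpos_of_twoDir hx (fun w => by simp only [lineFun1]; split_ifs <;> linarith) (twoDir_lineFun1 c b d)
  linarith

/-- hence the heavy rows of an atom are heavy rows of its peeling -/
theorem monoHeavy_sub_line {x : Col t} (hx : Balanced x) (v : Tri t → ℝ) {c : ℝ} (hc : 0 ≤ c) (b d : Fin t)
    (hv : MonoHeavy x v) : MonoHeavy x (fun w => v w - lineFun1 c b d w) :=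
  lt_of_lt_of_le hv (heav_sub_line_ge hx v hc b d)

/-- **Reconstruction identity, registered form** (sub-goal `triangle_if_reconstruction` of stmt-PneNP-10680). -/
theorem triangle_if_reconstruction : ∀ {t : ℕ} {v : Tri t → ℝ} (f g h : Fin t → Fin t → ℝ), (∀ a b d, v (a, b, d) = f a b + g b d + h a d) → ∀ a b d : Fin t, (t : ℝ) ^ 3 * v (a, b, d) = (t : ℝ) ^ 2 * lineMass3 v a b d - t * planeMass3 v a b d + totalMass v :=
  fun f g h hv a b d => if_reconstruction f g h hv a b d

end

end Summit.PneNP.PneNP.Theorems.XorDoor.TriLine.Heavy
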